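import Summits.Ventures.PercRepro.RankLevelSetExplicitArithA

/-!
# PercRepro — explicit thresholds at every level: the arithmetic, part B (p9, S4)

The threshold `Tcore q = 2^{2^{q−1}+q+4}·q²` of THEOREM P (`proofs/SUBCLAIM-S4-p9.md`) with everything the
core theorem needs below it (`Tcore_bounds`), and the polynomial inequality `(P_d)` at EVERY `(q, d)` with
`q + 1 ≤ d ≤ q + 2^q` for `p ≥ Tcore q` (`poly_main`): `8·(C(p+d,q) + N) ≤ 7·2^{d−q}·C(p+q,q)` whenever
`N ≤ 2^{2^q−q−2}·(q−1)·2^{d+q}·C(p+d,q−2)` — the night-1 recipe (`level_arith`'s `hpoly`) at symbolic `q`, `d`,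
through the ratio and Bernoulli bounds of part A (`ratio_bounds`), two levels down in the binomial
(`choose_two_down`) and the constant `const_bound`. Axioms: standard.
-/

namespace PercRepro

namespace ThmN

namespace Explicit

/-- The core threshold `Tcore(q) = 2^{2^{q−1}+q+4}·q²` of THEOREM P. -/
def Tcore (q : ℕ) : ℕ := 2 ^ (2 ^ (q - 1) + q + 4) * q ^ 2

/-- `2·2^{q−1} = 2^q` for `q ≥ 1`. -/
theorem two_mul_two_pow_pred (q : ℕ) (hq : 1 ≤ q) : 2 * 2 ^ (q - 1) = 2 ^ q := by
  rw [← pow_succ']; congr 1; omega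

/-- `2^{q+4}·q² ≤ Tcore q`. -/
theorem two_pow_mul_sq_le_Tcore (q : ℕ) : 2 ^ (q + 4) * q ^ 2 ≤ Tcore q := by
  unfold Tcore
  apply Nat.mul_le_mul_right
  apply Nat.pow_le_pow_right (by norm_num)
  linarith [Nat.zero_le (2 ^ (q - 1))]

/-- `(Tcore q)² = 2^{2^q+2q+8}·q⁴` for `q ≥ 1`. -/
theorem Tcore_sq (q : ℕ) (hq : 1 ≤ q) : Tcore q ^ 2 = 2 ^ (2 ^ q + 2 * q + 8) * q ^ 4 := by
  unfold Tcore
  have h := two_mul_two_pow_pred q hq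
  have hexp : (2 ^ (q - 1) + q + 4) * 2 = 2 ^ q + 2 * q + 8 := by rw [← h]; ring
  rw [mul_pow, ← pow_mul, ← pow_mul, hexp]

/-- **(A0)** everything the core theorem needs is below `Tcore q` (`q ≥ 3`). -/
theorem Tcore_bounds (q : ℕ) (hq : 3 ≤ q) :
    2 ^ (q + 1) + 2 * q ^ 2 + 4 * q + 4 ≤ Tcore q ∧ 2 ^ (q + 1) + 3 * q + 2 ≤ Tcore q ∧
      2 ^ q + 2 ≤ Tcore q ∧ 16 * q * 2 ^ q ≤ Tcore q ∧ 3 * (q + 2 ^ q) + 5 ≤ Tcore q := by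
  have hx := succ_le_two_pow q
  have hT := two_pow_mul_sq_le_Tcore q
  rw [pow_add, show (2 : ℕ) ^ 4 = 16 by norm_num] at hT
  have h4x : 4 ≤ 2 ^ q := by omega
  have h9 : 9 ≤ q ^ 2 := by nlinarith
  -- three product facts, all linear in the atoms `2^q`, `q^2`, `2^q·q^2`, `q·2^q`
  have hA : 16 * q * 2 ^ q ≤ 8 * (2 ^ q * q ^ 2) := by
    have : 2 * q ≤ q ^ 2 := by nlinarith
    calc 16 * q * 2 ^ q = 8 * 2 ^ q * (2 * q) := by ring
      _ ≤ 8 * 2 ^ q * q ^ 2 := Nat.mul_le_mul_left _ this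
      _ = 8 * (2 ^ q * q ^ 2) := by ring
  have hB : 2 * q ^ 2 + 10 * q + 13 ≤ 4 * (2 ^ q * q ^ 2) := by
    have h1 : 16 * q ^ 2 ≤ 4 * (2 ^ q * q ^ 2) := by
      calc 16 * q ^ 2 = 4 * (4 * q ^ 2) := by ring
        _ ≤ 4 * (2 ^ q * q ^ 2) := Nat.mul_le_mul_left _ (Nat.mul_le_mul_right _ h4x)
    have h2 : 2 * q ^ 2 + 10 * q + 13 ≤ 16 * q ^ 2 := by nlinarith
    omega
  have hC : 8 * 2 ^ q ≤ 4 * (2 ^ q * q ^ 2) := by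
    calc 8 * 2 ^ q ≤ 2 ^ q * 36 := by omega
      _ = 4 * (2 ^ q * 9) := by ring
      _ ≤ 4 * (2 ^ q * q ^ 2) := Nat.mul_le_mul_left _ (Nat.mul_le_mul_left _ h9)
  have hT' : 16 * (2 ^ q * q ^ 2) ≤ Tcore q := by
    calc 16 * (2 ^ q * q ^ 2) = 2 ^ q * 16 * q ^ 2 := by ring
      _ ≤ Tcore q := hT
  rw [pow_succ]
  refine ⟨?_, ?_, ?_, ?_, ?_⟩ <;> omega

/-- `2^{2^q+2q+8} = 2^{2^q−q−2}·2^{3q+10}` (`q ≥ 2`). -/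
theorem two_pow_split (q : ℕ) (hq : 2 ≤ q) :
    2 ^ (2 ^ q + 2 * q + 8) = 2 ^ (2 ^ q - q - 2) * 2 ^ (3 * q + 10) := by
  have h1 := succ_le_two_pow (q - 1)
  have h2 := two_mul_two_pow_pred q (by omega)
  have hq2 : q + 2 ≤ 2 ^ q := by omega
  rw [← pow_add]; congr 1; omega

/-- `16·y³ ≤ 5·2⁹·y⁴` for `y ≥ 1`. -/
theorem sixteen_cube_le (y : ℕ) (hy : 1 ≤ y) : 16 * y ^ 3 ≤ 5 * 2 ^ 9 * y ^ 4 := by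
  calc 16 * y ^ 3 = 16 * y ^ 3 * 1 := by ring
    _ ≤ 16 * y ^ 3 * y := Nat.mul_le_mul_left _ hy
    _ = 16 * y ^ 4 := by ring
    _ ≤ 5 * 2 ^ 9 * y ^ 4 := Nat.mul_le_mul_right _ (by norm_num)

/-- **(A5-i)** the ratio bounds: for `2q(m+1) ≤ p+1`, `8·C(n,q) ≤ 9·C(p+q,q)` and `C(n,q) ≤ 2·C(p+q,q)` where
`n = p + q + 1 + m`, provided also `16q(m+1) ≤ p + 1`. -/
theorem ratio_bounds (q m p : ℕ) (h16 : 8 * (2 * q * (m + 1)) ≤ p + 1) :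
    8 * (p + q + 1 + m).choose q ≤ 9 * (p + q).choose q ∧
      (p + q + 1 + m).choose q ≤ 2 * (p + q).choose q := by
  have h2qm : 2 * q * (m + 1) ≤ p + 1 := by omega
  have hR := choose_mul_pow_le_choose_mul_pow p q (q + 1 + m) (by omega)
  rw [show q + 1 + m - q = m + 1 by omega, show p + (q + 1 + m) = p + q + 1 + m by omega] at hR
  have hB := add_pow_mul_le_pow_mul (p + 1) (m + 1) q h2qm
  have hpos : 0 < (p + 1) ^ q := by positivity
  have hp1 : 0 < p + 1 := by omega
  have h1 : (p + q + 1 + m).choose q * (p + 1) ≤ (p + q).choose q * (p + 1 + 2 * q * (m + 1)) := by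
    apply Nat.le_of_mul_le_mul_left _ hpos
    calc (p + 1) ^ q * ((p + q + 1 + m).choose q * (p + 1))
        = ((p + q + 1 + m).choose q * (p + 1) ^ q) * (p + 1) := by ring
      _ ≤ ((p + q).choose q * (p + 1 + (m + 1)) ^ q) * (p + 1) := Nat.mul_le_mul_right _ hR
      _ = (p + q).choose q * ((p + 1 + (m + 1)) ^ q * (p + 1)) := by ring
      _ ≤ (p + q).choose q * ((p + 1) ^ q * (p + 1 + 2 * q * (m + 1))) := Nat.mul_le_mul_left _ hB
      _ = (p + 1) ^ q * ((p + q).choose q * (p + 1 + 2 * q * (m + 1))) := by ring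
  constructor
  · apply Nat.le_of_mul_le_mul_right _ hp1
    calc 8 * (p + q + 1 + m).choose q * (p + 1) = 8 * ((p + q + 1 + m).choose q * (p + 1)) := by ring
      _ ≤ 8 * ((p + q).choose q * (p + 1 + 2 * q * (m + 1))) := Nat.mul_le_mul_left _ h1
      _ = (p + q).choose q * (8 * (p + 1 + 2 * q * (m + 1))) := by ring
      _ ≤ (p + q).choose q * (9 * (p + 1)) := Nat.mul_le_mul_left _ (by omega)
      _ = 9 * (p + q).choose q * (p + 1) := by ring
  · apply Nat.le_of_mul_le_mul_right _ hp1
    calc (p + q + 1 + m).choose q * (p + 1) ≤ (p + q).choose q * (p + 1 + 2 * q * (m + 1)) := h1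
      _ ≤ (p + q).choose q * (2 * (p + 1)) := Nat.mul_le_mul_left _ (by omega)
      _ = 2 * (p + q).choose q * (p + 1) := by ring

/-- **(A5-iii)** two levels down: `(p+1)²·C(n, q') ≤ (q'+2)(q'+1)·C(n, q'+2)` when `p + 2 ≤ n − q' − 1`. -/
theorem choose_two_down (n q' p : ℕ) (hn : p + q' + 3 ≤ n) :
    (p + 1) ^ 2 * n.choose q' ≤ (q' + 2) * (q' + 1) * n.choose (q' + 2) := by
  have h4a := Nat.choose_succ_right_eq n (q' + 1)
  have h4b := Nat.choose_succ_right_eq n q'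
  have h4 : n.choose (q' + 2) * ((q' + 2) * (q' + 1)) = n.choose q' * ((n - (q' + 1)) * (n - q')) := by
    calc n.choose (q' + 2) * ((q' + 2) * (q' + 1))
        = (n.choose (q' + 1 + 1) * (q' + 1 + 1)) * (q' + 1) := by ring
      _ = (n.choose (q' + 1) * (n - (q' + 1))) * (q' + 1) := by rw [h4a]
      _ = (n.choose (q' + 1) * (q' + 1)) * (n - (q' + 1)) := by ring
      _ = (n.choose q' * (n - q')) * (n - (q' + 1)) := by rw [h4b]
      _ = n.choose q' * ((n - (q' + 1)) * (n - q')) := by ring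
  have hn1 : p + 1 ≤ n - (q' + 1) := by omega
  have hn2 : p + 1 ≤ n - q' := by omega
  calc (p + 1) ^ 2 * n.choose q' = n.choose q' * ((p + 1) * (p + 1)) := by ring
    _ ≤ n.choose q' * ((n - (q' + 1)) * (n - q')) := Nat.mul_le_mul_left _ (Nat.mul_le_mul hn1 hn2)
    _ = n.choose (q' + 2) * ((q' + 2) * (q' + 1)) := h4.symm
    _ = (q' + 2) * (q' + 1) * n.choose (q' + 2) := by ring

/-- **(A5-iv)** the constant: `16·(q'+2)(q'+1)²·2^{2(q'+2)+1} ≤ 5·2^{3(q'+2)+10}·(q'+2)⁴`. -/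
theorem const_bound (q' : ℕ) : 16 * ((q' + 2) * (q' + 1) ^ 2) * 2 ^ (2 * (q' + 2) + 1) ≤
    5 * 2 ^ (3 * (q' + 2) + 10) * (q' + 2) ^ 4 := by
  have e : 2 ^ (3 * (q' + 2) + 10) = 2 ^ (2 * (q' + 2) + 1) * 2 ^ (q' + 11) := by
    rw [← pow_add]; congr 1; ring
  rw [e]
  have h512 : 2 ^ 9 ≤ 2 ^ (q' + 11) := Nat.pow_le_pow_right (by norm_num) (by omega)
  have hq1 : (q' + 1) ^ 2 ≤ (q' + 2) ^ 2 := Nat.pow_le_pow_left (by omega) 2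
  have hcube := sixteen_cube_le (q' + 2) (by omega)
  calc 16 * ((q' + 2) * (q' + 1) ^ 2) * 2 ^ (2 * (q' + 2) + 1)
      ≤ 16 * ((q' + 2) * (q' + 2) ^ 2) * 2 ^ (2 * (q' + 2) + 1) :=
        Nat.mul_le_mul_right _ (Nat.mul_le_mul_left _ (Nat.mul_le_mul_left _ hq1))
    _ = 2 ^ (2 * (q' + 2) + 1) * (16 * (q' + 2) ^ 3) := by ring
    _ ≤ 2 ^ (2 * (q' + 2) + 1) * (5 * 2 ^ 9 * (q' + 2) ^ 4) := Nat.mul_le_mul_left _ hcube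
    _ ≤ 2 ^ (2 * (q' + 2) + 1) * (5 * 2 ^ (q' + 11) * (q' + 2) ^ 4) :=
        Nat.mul_le_mul_left _ (Nat.mul_le_mul_right _ (Nat.mul_le_mul_left _ h512))
    _ = 5 * (2 ^ (2 * (q' + 2) + 1) * 2 ^ (q' + 11)) * (q' + 2) ^ 4 := by ring

/-- **(A5-iv′)** the `N`-term: `8N ≤ 5·2^m·C` from `N ≤ σ₀(q'+1)2^{2(q'+2)+1+m}·Cm`, `(p+1)²·Cm ≤ (q'+2)(q'+1)·Cn`,
`Cn ≤ 2C` and `σ₀·2^{3(q'+2)+10}(q'+2)⁴ ≤ (p+1)²`. -/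
theorem N_term_bound (q' m p N σ₀ Cm Cn C : ℕ)
    (hN : N ≤ σ₀ * (q' + 1) * 2 ^ (2 * (q' + 2) + 1 + m) * Cm)
    (h5 : (p + 1) ^ 2 * Cm ≤ (q' + 2) * (q' + 1) * Cn) (h3 : Cn ≤ 2 * C)
    (hsq : σ₀ * 2 ^ (3 * (q' + 2) + 10) * (q' + 2) ^ 4 ≤ (p + 1) ^ 2) :
    8 * N ≤ 5 * 2 ^ m * C := by
  have hp2 : 0 < (p + 1) ^ 2 := by positivity
  apply Nat.le_of_mul_le_mul_right _ hp2
  have hsplit : 2 ^ (2 * (q' + 2) + 1 + m) = 2 ^ (2 * (q' + 2) + 1) * 2 ^ m := pow_add _ _ _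
  have hkey := const_bound q'
  calc 8 * N * (p + 1) ^ 2
      ≤ 8 * (σ₀ * (q' + 1) * 2 ^ (2 * (q' + 2) + 1 + m) * Cm) * (p + 1) ^ 2 :=
        Nat.mul_le_mul_right _ (Nat.mul_le_mul_left _ hN)
    _ = 8 * σ₀ * (q' + 1) * 2 ^ (2 * (q' + 2) + 1 + m) * ((p + 1) ^ 2 * Cm) := by ring
    _ ≤ 8 * σ₀ * (q' + 1) * 2 ^ (2 * (q' + 2) + 1 + m) * ((q' + 2) * (q' + 1) * Cn) :=
        Nat.mul_le_mul_left _ h5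
    _ ≤ 8 * σ₀ * (q' + 1) * 2 ^ (2 * (q' + 2) + 1 + m) * ((q' + 2) * (q' + 1) * (2 * C)) :=
        Nat.mul_le_mul_left _ (Nat.mul_le_mul_left _ h3)
    _ = (16 * ((q' + 2) * (q' + 1) ^ 2) * 2 ^ (2 * (q' + 2) + 1)) * (σ₀ * 2 ^ m * C) := by
        rw [hsplit]; ring
    _ ≤ (5 * 2 ^ (3 * (q' + 2) + 10) * (q' + 2) ^ 4) * (σ₀ * 2 ^ m * C) :=
        Nat.mul_le_mul_right _ hkey
    _ = 5 * 2 ^ m * C * (σ₀ * 2 ^ (3 * (q' + 2) + 10) * (q' + 2) ^ 4) := by ring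
    _ ≤ 5 * 2 ^ m * C * (p + 1) ^ 2 := Nat.mul_le_mul_left _ hsq

/-- **(A5) THE POLYNOMIAL INEQUALITY AT EVERY `(q, d)`**, `d = q + 1 + m`, `m + 1 ≤ 2^q`, `p ≥ Tcore q`:
`8·(C(p+d, q) + N) ≤ 7·2^{d−q}·C(p+q, q)` whenever `N ≤ 2^{2^q−q−2}·(q−1)·2^{d+q}·C(p+d, q−2)`. -/
theorem poly_main (q m p N : ℕ) (hq : 3 ≤ q) (hm : m + 1 ≤ 2 ^ q) (hp : Tcore q ≤ p)
    (hN : N ≤ 2 ^ (2 ^ q - q - 2) * (q - 1) * 2 ^ (2 * q + 1 + m) * (p + q + 1 + m).choose (q - 2)) :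
    8 * ((p + q + 1 + m).choose q + N) ≤ 7 * 2 ^ (m + 1) * (p + q).choose q := by
  obtain ⟨q', rfl⟩ : ∃ q', q = q' + 2 := ⟨q - 2, by omega⟩
  obtain ⟨-, -, -, h16, -⟩ := Tcore_bounds (q' + 2) hq
  have e1 : q' + 2 - 1 = q' + 1 := by omega
  have e2 : q' + 2 - 2 = q' := by omega
  rw [e1, e2] at hN
  -- the thresholds in the form the pieces want
  have h16m : 8 * (2 * (q' + 2) * (m + 1)) ≤ p + 1 := by
    calc 8 * (2 * (q' + 2) * (m + 1)) ≤ 8 * (2 * (q' + 2) * 2 ^ (q' + 2)) :=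
          Nat.mul_le_mul_left _ (Nat.mul_le_mul_left _ hm)
      _ = 16 * (q' + 2) * 2 ^ (q' + 2) := by ring
      _ ≤ p + 1 := by omega
  obtain ⟨h2, h3⟩ := ratio_bounds (q' + 2) m p h16m
  have h5 := choose_two_down (p + (q' + 2) + 1 + m) q' p (by omega)
  have hsq : 2 ^ (2 ^ (q' + 2) - (q' + 2) - 2) * 2 ^ (3 * (q' + 2) + 10) * (q' + 2) ^ 4 ≤ (p + 1) ^ 2 := by
    have hT : Tcore (q' + 2) ^ 2 ≤ (p + 1) ^ 2 := Nat.pow_le_pow_left (by omega) 2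
    rw [Tcore_sq (q' + 2) (by omega), two_pow_split (q' + 2) (by omega)] at hT
    exact hT
  have h6 := N_term_bound q' m p N _ _ _ _ hN h5 h3 hsq
  have h7 : 9 + 5 * 2 ^ m ≤ 7 * 2 ^ (m + 1) := by
    have : 1 ≤ 2 ^ m := Nat.one_le_two_pow
    rw [pow_succ]; omega
  calc 8 * ((p + (q' + 2) + 1 + m).choose (q' + 2) + N)
      = 8 * (p + (q' + 2) + 1 + m).choose (q' + 2) + 8 * N := by ring
    _ ≤ 9 * (p + (q' + 2)).choose (q' + 2) + 5 * 2 ^ m * (p + (q' + 2)).choose (q' + 2) :=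
        Nat.add_le_add h2 h6
    _ = (9 + 5 * 2 ^ m) * (p + (q' + 2)).choose (q' + 2) := by ring
    _ ≤ 7 * 2 ^ (m + 1) * (p + (q' + 2)).choose (q' + 2) := Nat.mul_le_mul_right _ h7

end Explicit

end ThmN

end PercRepro
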